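import Summits.QuantumFields.YangMills.Theorems.SwapVirialDeficitSectorLaplaceTipFibreFloor
import Summits.QuantumFields.YangMills.Theorems.SwapVirialDeficitBlowUpGnomonicLeaderGroupDistApex
import Summits.QuantumFields.YangMills.Theorems.SwapVirialDeficitBlowUpGnomonicRotCovariance
import HarnessLib

/-!
# F4-ORIG: THE FIBRE BOUND ON THE SMALL-LEADER REGION `ORIG` of w2 g61's aligned-rotation assembly — no rotation (`u = 1`), reference base point `p′ = (x₀, y₀)`
# (cell ym-idea-1, skeleton ➎ v14, `stub_core_tip`, socket (hCore) → `hLLm` → region socket `leaderLayer_ORIG`; LEAD seat ym-line-sfw-p2 g100 (division of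
# 2026-09-01 02:11Z: ORIG = LEAD, PX∕PY = w2), free-hands support of ⟨stmt-QuantumFields-24197⟩ `SwapVirialDeficit.SwapGluedStiffness`)

On `ORIG` the transverse letters are tiny, `x₁²+x₂², y₁²+y₂² ≤ s² = (1+δt²)⁻¹`, so the un-rotated leader point is flat-near the base point `gnoBase x₀ y₀` in GROUP
distance (✓`leaderGroupDist_le_apex`: `D ≤ √2(|x⊥| + |y⊥|) + √(2|z|²/(1+|z|²))`) PROVIDED `z` is small — and `z` IS small whenever the point matters:
* if `|z|²/(1+|z|²) ≤ θ² := 7200L⁶κf` then `D ≤ 2√(2s²) + √(2θ²) ≤ ω` (window `s² ≤ ω²/32`, `2θ² ≤ ω²/16`) and ✓`tipFibre_le_four_cross` applies with `u = 1`,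
  `p′ = (x₀, y₀)`, `D = ω` (`3219264L⁴ω ≤ μ_F/(12|Fol|)`);
* else, by ✓`tip_four_floor`, `F̂ > κf` for EVERY follower configuration, so the fibre integral is below the far tail `e^{−b·rate}·∫piWeight` outright (`rate ≤ κf`).
★★ `tipFibre_ORIG` — the conclusion of ✓`tipFibre_le_four_cross` VERBATIM with `p′ := (x₀, y₀)`, under the ORIG smallness and the two window inequalities; no `u`, no `D`.
Helpers: `far_rate_le_kf`, `sqrt_two_mul_div_le`, `orig_groupDist_le`.

HONEST LABEL: one pointwise brick; `leaderLayer_ORIG` (the integration, next file), `hLLm`, (hCore), `stub_core_tip`, ⟨24197⟩ ∕ ⟨24194⟩ OPEN; own crux ⟨22884⟩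
`LargeFieldMassRefinementTail` OPEN (blocked-on ⟨19935⟩); the Yang–Mills mass gap is NOT proved; no summit is proved by a line.  THEOREMS ONLY (0 `def`, 0 `sorry`, no
instance, no notation), standard axioms.  `--supports stmt-QuantumFields-24197`.  References: [cite: Luscher1983, §2]; [folklore].
-/

set_option autoImplicit false
set_option synthInstance.maxSize 1024

noncomputable section

open MeasureTheory Quaternion Set Module
open scoped Quaternion BigOperators ENNReal InnerProductSpace
open Literature.MathematicalPhysics.QuantumLattice
open Literature.MathematicalPhysics.QuantumFieldTheory hiding SU2

namespace Summit.QuantumFields.YangMills.Theorems.SwapVirialDeficit.SectorLaplace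

open Summit.QuantumFields.YangMills.Theorems.FemtoTransferGap
open Summit.QuantumFields.YangMills.Theorems.FemtoTransferGap.TT
open Summit.QuantumFields.YangMills.Theorems.VirialFluxGap.RingDeficit
open Summit.QuantumFields.YangMills.Theorems.SwapVirialDeficit.SwapRing
open Summit.QuantumFields.YangMills.Theorems.SwapVirialDeficit.BlowUpRing
open Summit.QuantumFields.YangMills.Theorems.SwapVirialDeficit.Gnomonic (piWeight piWeight_pos piWeight_le_one)

variable {L : ℕ} [NeZero L]

/-! ## §1 Small helpers -/

omit [NeZero L] in
/-- The far rate is below `κf`: `min(sT²)(κf/(300L⁴))/(3600L⁶) ≤ κf` (`κf ≥ 0`, `L ≥ 1`). [folklore] -/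
theorem far_rate_le_kf {sT κf Lr : ℝ} (hκf : 0 ≤ κf) (hL : 1 ≤ Lr) :
    min (sT ^ 2) (κf / (300 * Lr ^ 4)) / (3600 * Lr ^ 6) ≤ κf := by
  have hL4 : 1 ≤ Lr ^ 4 := one_le_pow₀ hL
  have hL6 : 1 ≤ Lr ^ 6 := one_le_pow₀ hL
  have h1 : min (sT ^ 2) (κf / (300 * Lr ^ 4)) ≤ κf / (300 * Lr ^ 4) := min_le_right _ _
  have h2 : κf / (300 * Lr ^ 4) ≤ κf := div_le_self hκf (by nlinarith)
  have h3 : min (sT ^ 2) (κf / (300 * Lr ^ 4)) / (3600 * Lr ^ 6) ≤ min (sT ^ 2) (κf / (300 * Lr ^ 4)) / 1 :=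
    by
      rcases le_or_gt 0 (min (sT ^ 2) (κf / (300 * Lr ^ 4))) with h | h
      · exact div_le_div_of_nonneg_left h one_pos (by nlinarith)
      · -- negative numerator: dividing by a number ≥ 1 moves it up towards 0, still ≤ itself/1? No: use `≤ 0 ≤ κf` directly below.
        have : min (sT ^ 2) (κf / (300 * Lr ^ 4)) / (3600 * Lr ^ 6) ≤ 0 := div_nonpos_of_nonpos_of_nonneg h.le (by positivity)
        have h0 : (0 : ℝ) ≤ sT ^ 2 := sq_nonneg _
        have : 0 ≤ min (sT ^ 2) (κf / (300 * Lr ^ 4)) := le_min h0 (by positivity)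
        linarith
  rw [div_one] at h3
  linarith

omit [NeZero L] in
/-- `√(2t/(1+X)) ≤ √(2c)` for `0 ≤ t ≤ c`, `0 ≤ X`. [folklore] -/
theorem sqrt_two_mul_div_le {t X c : ℝ} (ht0 : 0 ≤ t) (htc : t ≤ c) (hX : 0 ≤ X) : Real.sqrt (2 * t / (1 + X)) ≤ Real.sqrt (2 * c) := by
  apply Real.sqrt_le_sqrt
  calc 2 * t / (1 + X) ≤ 2 * t := div_le_self (by positivity) (by linarith)
    _ ≤ 2 * c := by linarith

omit [NeZero L] in
/-- `√(a²/16) = a/4` for `a ≥ 0`. [folklore] -/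
theorem sqrt_sq_div_sixteen {a : ℝ} (ha : 0 ≤ a) : Real.sqrt (a ^ 2 / 16) = a / 4 := by
  rw [show a ^ 2 / 16 = (a / 4) ^ 2 by ring, Real.sqrt_sq (by positivity)]

omit [NeZero L] in
/-- ★ THE ORIG GROUP DISTANCE: for `x₁²+x₂², y₁²+y₂² ≤ s²`, `|z|²/(1+|z|²) ≤ θ²`, `s² ≤ ω²/32`, `2θ² ≤ ω²/16`, the un-rotated leader point is within `ω` of
`gnoBase x₀ y₀` in the four leader-tuple entries at the apex hub. [folklore] -/
theorem orig_groupDist_le (ε : GnoSign L) (x y z : Fin 3 → ℝ) {s2 θ2 ω : ℝ} (hω : 0 ≤ ω)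
    (hx : (x 1) ^ 2 + (x 2) ^ 2 ≤ s2) (hy : (y 1) ^ 2 + (y 2) ^ 2 ≤ s2)
    (hz : ((z 0) ^ 2 + (z 1) ^ 2 + (z 2) ^ 2) / (1 + ((z 0) ^ 2 + (z 1) ^ 2 + (z 2) ^ 2)) ≤ θ2)
    (hsω : s2 ≤ ω ^ 2 / 32) (hθω : 2 * θ2 ≤ ω ^ 2 / 16) (μ : Fin 4) :
    ‖su2Quat ((blowUpPoint (L := L) 1 (gnomonicPoint ((1 : ℝ) : ℍ) ε (gnoBase (x 0) (y 0)))).1 μ) -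
        su2Quat ((blowUpPoint (L := L) 1 (gnomonicPoint ((1 : ℝ) : ℍ) ε
          (gnoRot (star (1 : ℍ)) ((((x, y), (z, (0 : Fol L → Fin 3 → ℝ))) : GnoCoord L))))).1 μ)‖ ≤ ω := by
  rw [star_one, gnoRot_one]
  have h := leaderGroupDist_le_apex (L := L) ε x y z 0 0 μ
  have e : (gnoBase (L := L) (x 0) (y 0)) = ((((![x 0, 0, 0] : Fin 3 → ℝ), (![y 0, 0, 0] : Fin 3 → ℝ)), ((0 : Fin 3 → ℝ), (0 : Fol L → Fin 3 → ℝ))) : GnoCoord L) := rfl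
  rw [e]
  refine h.trans ?_
  have hxn : 0 ≤ (x 0) ^ 2 + (x 1) ^ 2 + (x 2) ^ 2 := by positivity
  have hyn : 0 ≤ (y 0) ^ 2 + (y 1) ^ 2 + (y 2) ^ 2 := by positivity
  have h1 : Real.sqrt (2 * ((x 1) ^ 2 + (x 2) ^ 2) / (1 + ((x 0) ^ 2 + (x 1) ^ 2 + (x 2) ^ 2))) ≤ ω / 4 := by
    refine (sqrt_two_mul_div_le (by positivity) hx hxn).trans ?_
    rw [← sqrt_sq_div_sixteen hω]
    exact Real.sqrt_le_sqrt (by linarith)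
  have h3 : Real.sqrt (2 * ((y 1) ^ 2 + (y 2) ^ 2) / (1 + ((y 0) ^ 2 + (y 1) ^ 2 + (y 2) ^ 2))) ≤ ω / 4 := by
    refine (sqrt_two_mul_div_le (by positivity) hy hyn).trans ?_
    rw [← sqrt_sq_div_sixteen hω]
    exact Real.sqrt_le_sqrt (by linarith)
  have h2 : Real.sqrt (2 * ((z 0) ^ 2 + (z 1) ^ 2 + (z 2) ^ 2) / (1 + ((z 0) ^ 2 + (z 1) ^ 2 + (z 2) ^ 2))) ≤ ω / 4 := by
    rw [← sqrt_sq_div_sixteen hω]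
    apply Real.sqrt_le_sqrt
    rw [mul_div_assoc]
    linarith
  linarith

/-! ## §2 The fibre bound on ORIG -/

set_option maxHeartbeats 800000 in
/-- ★★ **F4-ORIG: THE FIBRE BOUND ON THE SMALL-LEADER REGION.**  For good `ε`, the tip hub `hubAt δt 1` in the window of ✓`tipFibre_le`, an apex follower family `A₀`,
T1's thresholds `sT, κf`, a leader point with `x₁²+x₂², y₁²+y₂² ≤ (1+δt²)⁻¹`, and the two ORIG windows `(1+δt²)⁻¹ ≤ ω²/32`, `2·7200L⁶κf ≤ ω²/16` for a matching radius
`0 < ω ≤ 1` with `3219264L⁴ω ≤ μ_F/(12|Fol|)`: the conclusion of ✓`tipFibre_le_four_cross` with the reference base point `p′ = (x₀, y₀)`. [cite: Luscher1983, §2] -/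
theorem tipFibre_ORIG {ε : GnoSign L} (hε : GoodSign ε) {δt : ℝ} (hδt : 0 < δt)
    (hwinδ : 122689728 * δt⁻¹ * (L : ℝ) ^ 4 ≤ (2304 * (L : ℝ) ^ 6 * (Fintype.card (Fol L) : ℝ))⁻¹ / (8 * (3 * (Fintype.card (Fol L) : ℝ))))
    {A0 : GnoCoord L → GnoFol L →ₗ[ℝ] GnoFol L} (hA0s : ∀ η, (A0 η).IsSymmetric)
    (hA0yy : ∀ η (y : GnoFol L), ⟪A0 η y, y⟫_ℝ = iteratedFDeriv ℝ 2 (fun y' : GnoFol L => gnoDeficit z₀ (fun _ => 1) ((1 : ℝ) : ℍ) ε (η + gnoFolEmb y')) 0 (fun _ => y))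
    (hA0ray : ∀ η (y : GnoFol L), ⟪A0 η y, y⟫_ℝ = iteratedDeriv 2 (fun s : ℝ => gnoDeficit (fun _ => false) (fun _ => 1) ((1 : ℝ) : ℍ) ε (η + s • gnoFolEmb y)) 0)
    (hA0amb : ∀ η (y : GnoFol L), ⟪A0 η y, y⟫_ℝ = iteratedFDeriv ℝ 2 (gnoDeficit z₀ (fun _ => 1) ((1 : ℝ) : ℍ) ε) η (fun _ => gnoFolEmb y))
    (x y z : Fin 3 → ℝ) {sT κf : ℝ} (hsT : 0 ≤ sT) (hκf0 : 0 ≤ κf)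
    (hs2 : sT ^ 2 ≤ ((2304 * (L : ℝ) ^ 6 * (Fintype.card (Fol L) : ℝ))⁻¹) ^ 2 / (304992000000 * (L : ℝ) ^ 8))
    (hκf : κf ≤ (2304 * (L : ℝ) ^ 6 * (Fintype.card (Fol L) : ℝ))⁻¹ * ((2304 * (L : ℝ) ^ 6 * (Fintype.card (Fol L) : ℝ))⁻¹ / (6 * (2484000 * (L : ℝ) ^ 4))) ^ 2 / 4)
    (hκwin : 44712000 * (L : ℝ) ^ 4 * Real.sqrt (κf / (2304 * (L : ℝ) ^ 6 * (Fintype.card (Fol L) : ℝ))⁻¹) ≤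
      (2304 * (L : ℝ) ^ 6 * (Fintype.card (Fol L) : ℝ))⁻¹ / (8 * (3 * (Fintype.card (Fol L) : ℝ))))
    (hx : (x 1) ^ 2 + (x 2) ^ 2 ≤ (1 + δt ^ 2)⁻¹) (hy : (y 1) ^ 2 + (y 2) ^ 2 ≤ (1 + δt ^ 2)⁻¹)
    {ω : ℝ} (hω0 : 0 < ω) (hω1 : ω ≤ 1)
    (hωwin : 3219264 * (L : ℝ) ^ 4 * ω ≤ (2304 * (L : ℝ) ^ 6 * (Fintype.card (Fol L) : ℝ))⁻¹ / (4 * (3 * (Fintype.card (Fol L) : ℝ))))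
    (hsω : (1 + δt ^ 2)⁻¹ ≤ ω ^ 2 / 32) (hθω : 2 * (7200 * (L : ℝ) ^ 6 * κf) ≤ ω ^ 2 / 16)
    {b : ℝ} (hb : 0 < b) :
    ∫⁻ F : Fol L → Fin 3 → ℝ, ENNReal.ofReal (Real.exp (-(b * gnoDeficit (fun _ => false) (fun _ => 1) (hubAt δt 1) ε (((x, y), (z, F)) : GnoCoord L))) * piWeight F) ≤
      ENNReal.ofReal (Real.exp (-(b * ((4 * δt ^ 2 * ((1 + δt ^ 2)⁻¹) ^ 2 * ((x 1) ^ 2 + (x 2) ^ 2) / (1 + ((x 0) ^ 2 + (x 1) ^ 2 + (x 2) ^ 2)) +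
          4 * (1 + δt ^ 2)⁻¹ * ((y 1) ^ 2 + (y 2) ^ 2) / (1 + ((y 0) ^ 2 + (y 1) ^ 2 + (y 2) ^ 2)) +
          4 * ((x 2 * y 0 - x 0 * y 2) ^ 2 + (x 0 * y 1 - x 1 * y 0) ^ 2) / ((1 + ((x 0) ^ 2 + (x 1) ^ 2 + (x 2) ^ 2)) * (1 + ((y 0) ^ 2 + (y 1) ^ 2 + (y 2) ^ 2))) +
          ((z 0) ^ 2 + (z 1) ^ 2 + (z 2) ^ 2) / (1 + ((z 0) ^ 2 + (z 1) ^ 2 + (z 2) ^ 2))) / (14400 * (L : ℝ) ^ 6) +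
      4 * ((x 1 * y 2 - x 2 * y 1) ^ 2 + (x 2 * y 0 - x 0 * y 2) ^ 2 + (x 0 * y 1 - x 1 * y 0) ^ 2) /
          ((1 + ((x 0) ^ 2 + (x 1) ^ 2 + (x 2) ^ 2)) * (1 + ((y 0) ^ 2 + (y 1) ^ 2 + (y 2) ^ 2))) / (3600 * (L : ℝ) ^ 6)))) *
          (Real.exp (3 / 2) * (2 * Real.pi / ((1 - 1 / (2 * (finrank ℝ (GnoFol L) : ℝ))) * b)) ^ ((finrank ℝ (GnoFol L) : ℝ) / 2) /
              Real.sqrt (LinearMap.det (A0 (gnoBase (x 0) (y 0)))) +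
            Real.exp (-(b * ((2304 * (L : ℝ) ^ 6 * (Fintype.card (Fol L) : ℝ))⁻¹ *
                (3 * ((2304 * (L : ℝ) ^ 6 * (Fintype.card (Fol L) : ℝ))⁻¹ / 2) / (2 * (finrank ℝ (GnoFol L) : ℝ) * (2484000 * (L : ℝ) ^ 4))) ^ 2 / 4))) *
              ∫ w : GnoFol L, piWeight (gnoFolBlocks w))) +
        ENNReal.ofReal (Real.exp (-(b * (min (sT ^ 2) (κf / (300 * (L : ℝ) ^ 4)) / (3600 * (L : ℝ) ^ 6))))) *
          ∫⁻ F : Fol L → Fin 3 → ℝ, ENNReal.ofReal (piWeight F) := by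
  have hL1 : (1 : ℝ) ≤ (L : ℝ) := by exact_mod_cast NeZero.one_le
  have hL0 : (0 : ℝ) < (L : ℝ) := by linarith
  by_cases hz : ((z 0) ^ 2 + (z 1) ^ 2 + (z 2) ^ 2) / (1 + ((z 0) ^ 2 + (z 1) ^ 2 + (z 2) ^ 2)) ≤ 7200 * (L : ℝ) ^ 6 * κf
  · -- small `z`: flat-near the base point `gnoBase x₀ y₀` with `u = 1`, `D = ω`
    have hD := orig_groupDist_le (L := L) ε x y z hω0.le hx hy hz hsω hθω
    have hu : ‖(1 : ℍ)‖ = 1 := norm_one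
    exact tipFibre_le_four_cross hε hδt hwinδ hA0s hA0yy hA0ray hA0amb x y z hsT hκf0 hs2 hκf hκwin hu ((x 0, y 0) : ℝ × ℝ) hω0 hω1 hD hωwin hb
  · -- large `z`: the `z`-floor alone puts every follower configuration in the far region
    have hzlt : 7200 * (L : ℝ) ^ 6 * κf < ((z 0) ^ 2 + (z 1) ^ 2 + (z 2) ^ 2) / (1 + ((z 0) ^ 2 + (z 1) ^ 2 + (z 2) ^ 2)) := not_le.1 hz
    have hfl : ∀ F : Fol L → Fin 3 → ℝ, κf ≤ gnoDeficit (fun _ => false) (fun _ => 1) (hubAt δt 1) ε (((x, y), (z, F)) : GnoCoord L) := by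
      intro F
      have h4 := tip_four_floor (L := L) δt ε (((x, y), (z, F)) : GnoCoord L)
      have hT1 : 0 ≤ 4 * δt ^ 2 * ((1 + δt ^ 2)⁻¹) ^ 2 * ((x 1) ^ 2 + (x 2) ^ 2) / (1 + ((x 0) ^ 2 + (x 1) ^ 2 + (x 2) ^ 2)) := by positivity
      have hT2 : 0 ≤ 4 * (1 + δt ^ 2)⁻¹ * ((y 1) ^ 2 + (y 2) ^ 2) / (1 + ((y 0) ^ 2 + (y 1) ^ 2 + (y 2) ^ 2)) := by positivity
      have hT3 : 0 ≤ 4 * ((x 2 * y 0 - x 0 * y 2) ^ 2 + (x 0 * y 1 - x 1 * y 0) ^ 2) /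
          ((1 + ((x 0) ^ 2 + (x 1) ^ 2 + (x 2) ^ 2)) * (1 + ((y 0) ^ 2 + (y 1) ^ 2 + (y 2) ^ 2))) := by positivity
      have hL6 : 0 < 7200 * (L : ℝ) ^ 6 := by positivity
      have key : 7200 * (L : ℝ) ^ 6 * κf < 7200 * (L : ℝ) ^ 6 * gnoDeficit (fun _ => false) (fun _ => 1) (hubAt δt 1) ε (((x, y), (z, F)) : GnoCoord L) := by
        have := h4
        simp only at this
        linarith
      exact (lt_of_mul_lt_mul_left key hL6.le).le
    have hrate := far_rate_le_kf (sT := sT) hκf0 hL1 (Lr := (L : ℝ))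
    calc ∫⁻ F : Fol L → Fin 3 → ℝ, ENNReal.ofReal (Real.exp (-(b * gnoDeficit (fun _ => false) (fun _ => 1) (hubAt δt 1) ε (((x, y), (z, F)) : GnoCoord L))) * piWeight F)
        ≤ ∫⁻ F : Fol L → Fin 3 → ℝ, ENNReal.ofReal (Real.exp (-(b * (min (sT ^ 2) (κf / (300 * (L : ℝ) ^ 4)) / (3600 * (L : ℝ) ^ 6))))) * ENNReal.ofReal (piWeight F) := by
          refine lintegral_mono fun F => ?_
          rw [← ENNReal.ofReal_mul (Real.exp_pos _).le]
          refine ENNReal.ofReal_le_ofReal (mul_le_mul_of_nonneg_right ?_ (piWeight_pos F).le)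
          exact Real.exp_le_exp.2 (neg_le_neg (mul_le_mul_of_nonneg_left (hrate.trans (hfl F)) hb.le))
      _ = ENNReal.ofReal (Real.exp (-(b * (min (sT ^ 2) (κf / (300 * (L : ℝ) ^ 4)) / (3600 * (L : ℝ) ^ 6))))) *
            ∫⁻ F : Fol L → Fin 3 → ℝ, ENNReal.ofReal (piWeight F) := lintegral_const_mul' _ _ ENNReal.ofReal_ne_top
      _ ≤ _ := le_add_self

end Summit.QuantumFields.YangMills.Theorems.SwapVirialDeficit.SectorLaplace

end
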